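import Mathlib
import Literature.MathematicalPhysics.QuantumFieldTheory.GaugeOSData
import Summits.QuantumFields.YangMills.Theorems.ConvexGribovBodyContinuumLegGivenGapStubAlongSequence
import Summits.QuantumFields.YangMills.Theorems.ConvexGribovBodyContinuumLegGivenGapThreshold
import Summits.QuantumFields.YangMills.Theorems.DirichletWindowCriticalityOfXiDiverges
import HarnessLib

/-!
# `ContinuumLegGivenGap` (stmt-QuantumFields-15828), line `Sketch` (reshape 7): around `stub_lock`

Support file for the crux item stmt-QuantumFields-15828 (registered stub `stub_lock` of the line
`Sketch`, reshape 7 — the IR "finite-size core": from per-β volume-uniform torus clustering produce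
ONE sequence `β_k → ∞` with rates `m̂_k > 0`, thresholds `S₁ k`, (UNIFORM) one constant per pair
`(A, B)` for ALL `k`, and (SHARP) no volume-uniform clustering at rate `4 m̂_k` at `β_k`).

The stub itself is NOT proved here (it is the open finite-size core: OS-norm constants at the true
spectral rate, cf. the torus clause of crux stmt-QuantumFields-9443). This file lands the honest
partial results around it, all pure logic over landed tree lemmas:

* `uniform_along_of_gapHyp`, `stub_lock_uniform` — the first THREE conjuncts of `stub_lock`
  (sequence `β_k := β₀ + k → ∞`, rates `m̂_k > 0`, thresholds `S₁ ≡ 0`, `k`-free pair constants) from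
  the crux's hypothesis, by threshold absorption (`stub_thresholdAbsorption`) and the landed
  sacrificed-rate requantisation `stub_alongSequence`; along ANY sequence above `β₀`.
* `rate_lt_of_sharp`, `not_sharp_of_clustering`, `stub_lock_pins_rate` — what SHARP buys: if rate
  `M` is not admissible beyond any volume threshold for some pair while rate `m` is admissible (with a
  threshold) for all pairs, then `m < M`; so the data of `stub_lock` pin `m̂_k` within the factor `4`
  of EVERY admissible rate at `β_k` (`m < 4 m̂_k`), and conversely an admissible rate `M` is never
  sharp (the borderline against a requantisation delivering only rate `m/4`, `m` admissible).
* `sharp_of_plaquetteCorrFn_lower`, `sharp_of_infiniteVolume_lower`, `sharp_eventually_of_xiDiverges`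
  — the SHARP conjunct from an infinite-volume input: an exponential LOWER bound
  `A e^{-m n} ≤ f_β(n e₀)` (`A > 0`, `m < M`) on Chatterjee's plaquette–plaquette function at every
  odd-torus limit state forbids volume-uniform clustering of the plaquette pair at rate `M` beyond any
  threshold (compactness along the odd tori and passage of torus bounds to the limit state, tree
  `CriticalityOfXiDiverges.*`); under `DirichletWindow.XiDiverges` (stmt-8941) this holds at every
  fixed rate `M > 0` for all large `β`; `stub_lock_of_uniform_of_lower` packages what remains
  (UNIFORM data at rates `m̂_k` with `4 m̂_k` above the infinite-volume lower rate at `β_k` ⇒ the stub's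
  conclusion).

No definitions, no facts; Mathlib + landed tree lemmas only. [folklore]
-/

noncomputable section

namespace Summit.QuantumFields.YangMills.Theorems.ContinuumLegGivenGap

open Filter Topology
open Literature.MathematicalPhysics.QuantumFieldTheory
open Literature.MathematicalPhysics.QuantumLattice

variable {G : Type} [Group G] [TopologicalSpace G] [IsTopologicalGroup G] [CompactSpace G]
  [MeasurableSpace G] [BorelSpace G]

/-! ### UNIFORM: the first three conjuncts of `stub_lock` -/

/-- **UNIFORM along any sequence above the threshold coupling.** If above `β₀` the tori at each `β`
cluster at some rate with some volume threshold and per-pair constants (the crux's hypothesis at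
`r`), then along ANY sequence `βs k ≥ β₀` there are rates `m̂_k > 0` and INDEX-FREE pair constants,
valid on all odd symmetric tori (`n ≤ S`, no threshold): threshold absorption at each index, then the
landed sacrificed-rate requantisation `stub_alongSequence`. [folklore] -/
theorem uniform_along_of_gapHyp (r : LatticeRep G) {β₀ : ℝ}
    (hGap : ∀ β : ℝ, β₀ ≤ β → ∃ m : ℝ, 0 < m ∧ ∃ S₁ : ℕ, ∀ A B : YMSpecies G, ∃ C : ℝ,
      ∀ S n : ℕ, S₁ ≤ S → n ≤ S →
        |latticeConnectedCorr r.ρ β (2 * S + 1) A.F B.F n| ≤ C * Real.exp (-(m * n)))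
    (βs : ℕ → ℝ) (hβs : ∀ k, β₀ ≤ βs k) :
    ∃ mh : ℕ → ℝ, (∀ k, 0 < mh k) ∧ ∀ A B : YMSpecies G, ∃ C : ℝ, ∀ k S n : ℕ, n ≤ S →
      |latticeConnectedCorr r.ρ (βs k) (2 * S + 1) A.F B.F n| ≤ C * Real.exp (-(mh k * n)) :=
  stub_alongSequence G r βs fun k => by
    obtain ⟨m, hm, S₁, hS⟩ := hGap (βs k) (hβs k)
    exact ⟨m, hm, stub_thresholdAbsorption G r (βs k) m S₁ hS⟩

/-- **The first three conjuncts of `stub_lock`** (UNIFORM, at sacrificed rates): from the crux's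
hypothesis at `r`, the sequence `β_k := β₀ + k → +∞`, rates `m̂_k > 0`, thresholds `S₁ ≡ 0` and ONE
constant per pair `(A, B)` for all `k`, `S`, `n ≤ S`. What `stub_lock` adds to this is the fourth
conjunct (SHARP), which these sacrificed rates need not satisfy. [folklore] -/
theorem stub_lock_uniform :
    ∀ (G : Type) [Group G] [TopologicalSpace G] [IsTopologicalGroup G] [CompactSpace G]
      [MeasurableSpace G] [BorelSpace G], IsCompactSimpleLieGroup G → ∀ r : LatticeRep G,
      (∃ β₀ : ℝ, ∀ β : ℝ, β₀ ≤ β → ∃ m : ℝ, 0 < m ∧ ∃ S₁ : ℕ, ∀ A B : YMSpecies G, ∃ C : ℝ,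
        ∀ S n : ℕ, S₁ ≤ S → n ≤ S →
          |latticeConnectedCorr r.ρ β (2 * S + 1) A.F B.F n| ≤ C * Real.exp (-(m * n))) →
      ∃ (β : ℕ → ℝ) (mh : ℕ → ℝ) (S₁ : ℕ → ℕ), Tendsto β atTop atTop ∧ (∀ k, 0 < mh k) ∧
        (∀ A B : YMSpecies G, ∃ C : ℝ, ∀ k S n : ℕ, S₁ k ≤ S → n ≤ S →
          |latticeConnectedCorr r.ρ (β k) (2 * S + 1) A.F B.F n| ≤
            C * Real.exp (-(mh k * n))) := by
  intro G _ _ _ _ _ _ _ r hGap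
  obtain ⟨β₀, hGap⟩ := hGap
  obtain ⟨mh, hmh, hC⟩ :=
    uniform_along_of_gapHyp r hGap (fun k => β₀ + k) fun k => by
      simp only [le_add_iff_nonneg_right, Nat.cast_nonneg]
  exact ⟨fun k => β₀ + k, mh, fun _ => 0, tendsto_atTop_add_const_left _ _ tendsto_natCast_atTop_atTop,
    hmh, fun A B => (hC A B).imp fun C hC k S n _ hn => hC k S n hn⟩

/-! ### What SHARP buys: the rate is pinned within the factor `4` -/

/-- **A sharp rate dominates every admissible rate.** At one coupling `β`: if rate `M` is NOT
admissible beyond any volume threshold for some pair (the SHARP shape: for every `S₀` a pair `(A, B)`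
with `|corr_{β,2S+1}(A, B; n)| > C e^{-M n}` for every `C` at some `S ≥ S₀`, `n ≤ S`), while rate `m`
IS admissible with threshold `S₁` and per-pair constants, then `m < M`. (Otherwise `e^{-m n} ≤ e^{-M n}`
and the pair's own constant `max C 0` is beaten.) [folklore] -/
theorem rate_lt_of_sharp (r : LatticeRep G) (β M m : ℝ) (S₁ : ℕ)
    (hclust : ∀ A B : YMSpecies G, ∃ C : ℝ, ∀ S n : ℕ, S₁ ≤ S → n ≤ S →
      |latticeConnectedCorr r.ρ β (2 * S + 1) A.F B.F n| ≤ C * Real.exp (-(m * n)))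
    (hsharp : ∀ S₀ : ℕ, ∃ A B : YMSpecies G, ∀ C : ℝ, ∃ S n : ℕ, S₀ ≤ S ∧ n ≤ S ∧
      C * Real.exp (-(M * n)) < |latticeConnectedCorr r.ρ β (2 * S + 1) A.F B.F n|) :
    m < M := by
  by_contra hle
  rw [not_lt] at hle
  obtain ⟨A, B, hAB⟩ := hsharp S₁
  obtain ⟨C, hC⟩ := hclust A B
  obtain ⟨S, n, hS, hn, hlt⟩ := hAB (max C 0)
  have h1 := hC S n hS hn
  have hexp : Real.exp (-(m * n)) ≤ Real.exp (-(M * n)) :=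
    Real.exp_le_exp.2 (neg_le_neg (mul_le_mul_of_nonneg_right hle (Nat.cast_nonneg n)))
  have h2 : C * Real.exp (-(m * n)) ≤ max C 0 * Real.exp (-(M * n)) :=
    (mul_le_mul_of_nonneg_right (le_max_left _ _) (Real.exp_pos _).le).trans
      (mul_le_mul_of_nonneg_left hexp (le_max_right _ _))
  exact absurd (h1.trans h2) (not_le.2 hlt)

/-- **An admissible rate is never sharp** (the borderline of the factor): if rate `M` is admissible at
`β` with a threshold and per-pair constants, the SHARP shape at rate `M` fails. In particular a
requantisation delivering `k`-uniform constants only at rate `m/4` with `m` itself admissible (e.g. `m`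
at most the infinite-volume transfer gap) does NOT give `stub_lock`'s fourth conjunct for
`m̂ := m/4`. [folklore] -/
theorem not_sharp_of_clustering (r : LatticeRep G) (β M : ℝ) (S₁ : ℕ)
    (hclust : ∀ A B : YMSpecies G, ∃ C : ℝ, ∀ S n : ℕ, S₁ ≤ S → n ≤ S →
      |latticeConnectedCorr r.ρ β (2 * S + 1) A.F B.F n| ≤ C * Real.exp (-(M * n))) :
    ¬ ∀ S₀ : ℕ, ∃ A B : YMSpecies G, ∀ C : ℝ, ∃ S n : ℕ, S₀ ≤ S ∧ n ≤ S ∧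
      C * Real.exp (-(M * n)) < |latticeConnectedCorr r.ρ β (2 * S + 1) A.F B.F n| :=
  fun hsharp => lt_irrefl M (rate_lt_of_sharp r β M M S₁ hclust hsharp)

/-- **`stub_lock`'s data pin the rate within the factor `4`.** For data `(β, m̂)` satisfying the SHARP
conjunct of `stub_lock`, at every index `k` EVERY rate `m` admissible at the coupling `β k` (some
threshold, per-pair constants — e.g. the crux's own rate `m(β k)`, or `m̂_k` itself by UNIFORM)
satisfies `m < 4 m̂_k`: the locked rate is at least a quarter of the best admissible one. [folklore] -/
theorem stub_lock_pins_rate (r : LatticeRep G) (β : ℕ → ℝ) (mh : ℕ → ℝ)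
    (hsharp : ∀ k S₀ : ℕ, ∃ A B : YMSpecies G, ∀ C : ℝ, ∃ S n : ℕ, S₀ ≤ S ∧ n ≤ S ∧
      C * Real.exp (-(4 * mh k * n)) < |latticeConnectedCorr r.ρ (β k) (2 * S + 1) A.F B.F n|)
    (k : ℕ) (m : ℝ) (S₁ : ℕ)
    (hclust : ∀ A B : YMSpecies G, ∃ C : ℝ, ∀ S n : ℕ, S₁ ≤ S → n ≤ S →
      |latticeConnectedCorr r.ρ (β k) (2 * S + 1) A.F B.F n| ≤ C * Real.exp (-(m * n))) :
    m < 4 * mh k :=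
  rate_lt_of_sharp r (β k) (4 * mh k) m S₁ hclust (hsharp k)

/-! ### SHARP from an infinite-volume lower bound -/

/-- **SHARP from a lower bound at the odd-torus limit states.** If every infinite-volume limit state
of the torus Wilson states along odd symmetric tori (`oddTorusLimitPoints r β`) has Chatterjee's
plaquette–plaquette function bounded BELOW, `A e^{-m n} ≤ f_β(n e₀)` for all `n` with `A > 0` and
`m < M`, then the plaquette pair does not cluster at rate `M` on the tori beyond any volume threshold:
for every `S₀` and every `C` some `S ≥ S₀`, `n ≤ S` has `|corr_{β,2S+1}(P, P; n)| > C e^{-M n}`.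
Proof: otherwise the torus bound passes to a limit state along the odd tori (compactness,
`exists_isInfiniteVolumeLimitAlong_odd`; `plaquetteCorrFn_le_of_abs_latticeConnectedCorr_le`), where it
contradicts the lower bound at the smaller rate (`false_of_exp_lower_le_upper`). [folklore] -/
theorem sharp_of_plaquetteCorrFn_lower (r : LatticeRep G) (β M : ℝ)
    (hlow : ∀ μ ∈ oddTorusLimitPoints r β, ∃ m A : ℝ, 0 < A ∧ m < M ∧
      ∀ n : ℕ, A * Real.exp (-(m * n)) ≤
        plaquetteCorrFn r.ρ μ ((n : ℤ) • Pi.single (0 : Fin 4) (1 : ℤ))) :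
    ∀ S₀ : ℕ, ∃ A B : YMSpecies G, ∀ C : ℝ, ∃ S n : ℕ, S₀ ≤ S ∧ n ≤ S ∧
      C * Real.exp (-(M * n)) < |latticeConnectedCorr r.ρ β (2 * S + 1) A.F B.F n| := by
  haveI : SecondCountableTopology G :=
    (r.continuous.isClosedEmbedding r.injective).isEmbedding.secondCountableTopology
  haveI : T2Space G := (r.continuous.isClosedEmbedding r.injective).isEmbedding.t2Space
  intro S₀
  refine ⟨plaquetteObservable (d := 4) r.ρ r.continuous 0 1,
    plaquetteObservable (d := 4) r.ρ r.continuous 0 1, fun C => ?_⟩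
  by_contra hno
  push Not at hno
  obtain ⟨μ, φ, hφ, hμ⟩ :=
    CriticalityOfXiDiverges.exists_isInfiniteVolumeLimitAlong_odd (d := 4) r.ρ r.continuous β
  obtain ⟨m, A, hA, hmM, hlowμ⟩ := hlow μ ⟨φ, hφ, hμ⟩
  have hup : ∀ n : ℕ, plaquetteCorrFn r.ρ μ ((n : ℤ) • Pi.single (0 : Fin 4) (1 : ℤ)) ≤
      C * Real.exp (-(M * n)) := fun n =>
    CriticalityOfXiDiverges.plaquetteCorrFn_le_of_abs_latticeConnectedCorr_le r.ρ r.continuous hφ hμ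
      (fun S hS hn => hno S n hS hn)
  exact CriticalityOfXiDiverges.false_of_exp_lower_le_upper hA hmM fun n => (hlowμ n).trans (hup n)

/-- Odd-torus limit states are infinite-volume limit points (sides `2 S_k + 1`, `S_k` strictly
increasing). [folklore] -/
theorem oddTorusLimitPoints_subset_infiniteVolumeLimitPoints (r : LatticeRep G) (β : ℝ) :
    oddTorusLimitPoints r β ⊆ infiniteVolumeLimitPoints (d := 4) r.ρ β := by
  rintro μ ⟨S, hS, hμ⟩
  exact ⟨fun k => 2 * S k, fun a b hab => by dsimp only; have := hS hab; omega, hμ⟩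

/-- **SHARP from a lower bound at all infinite-volume limit points** (the shape of one instance of
`DirichletWindow.XiDiverges`): `A e^{-m n} ≤ f_β(n e₀)`, `A > 0`, `m < M`, at every
`μ ∈ infiniteVolumeLimitPoints r.ρ β` forbids volume-uniform clustering of the plaquette pair at rate
`M` beyond any threshold. [folklore] -/
theorem sharp_of_infiniteVolume_lower (r : LatticeRep G) (β M : ℝ)
    (hlow : ∀ μ ∈ infiniteVolumeLimitPoints (d := 4) r.ρ β, ∃ m A : ℝ, 0 < A ∧ m < M ∧
      ∀ n : ℕ, A * Real.exp (-(m * n)) ≤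
        plaquetteCorrFn r.ρ μ ((n : ℤ) • Pi.single (0 : Fin 4) (1 : ℤ))) :
    ∀ S₀ : ℕ, ∃ A B : YMSpecies G, ∀ C : ℝ, ∃ S n : ℕ, S₀ ≤ S ∧ n ≤ S ∧
      C * Real.exp (-(M * n)) < |latticeConnectedCorr r.ρ β (2 * S + 1) A.F B.F n| :=
  sharp_of_plaquetteCorrFn_lower r β M fun μ hμ =>
    hlow μ (oddTorusLimitPoints_subset_infiniteVolumeLimitPoints r β hμ)

/-- **Under `XiDiverges` every fixed rate is eventually sharp.** `DirichletWindow.XiDiverges`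
(stmt-8941: at large `β` every limit state has `A e^{-m n} ≤ f_β(n e₀)` with `m ≤ ε`) implies: for
every `M > 0` there is `β₁` such that at every `β ≥ β₁` the plaquette pair does not cluster at rate `M`
beyond any volume threshold (SHARP shape at rate `M`). With `rate_lt_of_sharp` this re-derives
criticality (every admissible rate is eventually `< M`); for `stub_lock` it supplies the fourth
conjunct at `β_k` as soon as `4 m̂_k` stays above a fixed `M` — which criticality forbids along
`β_k → ∞`, so the finite-size core (uniform constants at a rate comparable to the best one) remains
the content. [folklore] -/
theorem sharp_eventually_of_xiDiverges (hXi : Summit.QuantumFields.YangMills.Theses.DirichletWindow.XiDiverges)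
    (hG : IsCompactSimpleLieGroup G) (r : LatticeRep G) (M : ℝ) (hM : 0 < M) :
    ∃ β₁ : ℝ, ∀ β : ℝ, β₁ ≤ β → ∀ S₀ : ℕ, ∃ A B : YMSpecies G, ∀ C : ℝ, ∃ S n : ℕ,
      S₀ ≤ S ∧ n ≤ S ∧
        C * Real.exp (-(M * n)) < |latticeConnectedCorr r.ρ β (2 * S + 1) A.F B.F n| := by
  obtain ⟨β₁, hβ₁⟩ := hXi G hG r (M / 2) (half_pos hM)
  refine ⟨β₁, fun β hβ => sharp_of_infiniteVolume_lower r β M fun μ hμ => ?_⟩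
  obtain ⟨m, A, hA, -, hmle, hlow⟩ := hβ₁ β hβ μ hμ
  exact ⟨m, A, hA, by linarith, hlow⟩

/-- **What remains of `stub_lock`, packaged.** Given data satisfying the first three conjuncts
(`β_k → ∞`, `m̂_k > 0`, thresholds, `k`-uniform pair constants — e.g. from `stub_lock_uniform`, or
from a finite-size core with OS-norm constants) such that at every `β_k` every infinite-volume limit
state has an exponential lower bound on the plaquette–plaquette function at a rate `< 4 m̂_k`, the
full conclusion of `stub_lock` holds. The open content is thus exactly: `k`-uniform constants at rates
`m̂_k` exceeding a quarter of the infinite-volume lower rate at `β_k`. [folklore] -/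
theorem stub_lock_of_uniform_of_lower (r : LatticeRep G) (β : ℕ → ℝ) (mh : ℕ → ℝ) (S₁ : ℕ → ℕ)
    (hβ : Tendsto β atTop atTop) (hmh : ∀ k, 0 < mh k)
    (hunif : ∀ A B : YMSpecies G, ∃ C : ℝ, ∀ k S n : ℕ, S₁ k ≤ S → n ≤ S →
      |latticeConnectedCorr r.ρ (β k) (2 * S + 1) A.F B.F n| ≤ C * Real.exp (-(mh k * n)))
    (hlow : ∀ k : ℕ, ∀ μ ∈ infiniteVolumeLimitPoints (d := 4) r.ρ (β k), ∃ m A : ℝ, 0 < A ∧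
      m < 4 * mh k ∧ ∀ n : ℕ, A * Real.exp (-(m * n)) ≤
        plaquetteCorrFn r.ρ μ ((n : ℤ) • Pi.single (0 : Fin 4) (1 : ℤ))) :
    ∃ (β : ℕ → ℝ) (mh : ℕ → ℝ) (S₁ : ℕ → ℕ), Tendsto β atTop atTop ∧ (∀ k, 0 < mh k) ∧
      (∀ A B : YMSpecies G, ∃ C : ℝ, ∀ k S n : ℕ, S₁ k ≤ S → n ≤ S →
        |latticeConnectedCorr r.ρ (β k) (2 * S + 1) A.F B.F n| ≤ C * Real.exp (-(mh k * n))) ∧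
      (∀ k S₀ : ℕ, ∃ A B : YMSpecies G, ∀ C : ℝ, ∃ S n : ℕ, S₀ ≤ S ∧ n ≤ S ∧
        C * Real.exp (-(4 * mh k * n)) < |latticeConnectedCorr r.ρ (β k) (2 * S + 1) A.F B.F n|) :=
  ⟨β, mh, S₁, hβ, hmh, hunif, fun k => sharp_of_infiniteVolume_lower r (β k) (4 * mh k) (hlow k)⟩

end Summit.QuantumFields.YangMills.Theorems.ContinuumLegGivenGap

end
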